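import Mathlib
import HarnessLib

/-!
# Tao 2016, §5: quadratic circuits and the three quadratic logic gates (pump, amplifier, rotor)

T. Tao, *Finite time blowup for an averaged three-dimensional Navier–Stokes equation*, J. Amer.
Math. Soc. **29** (2016) 601–674 = arXiv:1402.0290, §5 "Quadratic circuits" (pp. 25–28 of the
arXiv version). [`Tao2016AveragedNS`]

HONEST FRAMING (cell pub-fluidc): this file is part of a low prior, high value-of-information
experiment on Tao's machine paradigm; NOT a claim that NS blows up. It types the TOY MODEL of §5 —
finite-dimensional ODE — and proves its elementary conservation laws; nothing here is about the
Navier–Stokes equations themselves.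

## What §5 says (verbatim) and what is here

* (ode), (g-cancel), p. 25: "ODEs of the form `∂ₜX = G(X,X)` where `X : [t₁,t₂] → ℝ^m` … and
  `G : ℝ^m × ℝ^m → ℝ^m` is a bilinear operator obeying the cancellation condition `G(X,X)·X = 0` for
  all `X ∈ ℝ^m` (so in particular, the flow (ode) preserves the norm of `X`, and so the ODE is
  globally well posed)." Here: `QuadraticCircuit m` (structure constants `coeff i j k` of the
  bilinear `G` + the cancellation), the working predicate `IsCancelling F` ("`F(X)·X = 0`") for a
  vector field, `energy X = ∑ Xᵢ²`, and the PROVED conservation `energy_eq_of_isCancelling`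
  (global solutions have constant energy).
* §5.1 the PUMP (pump), (pomp): "`∂ₜx = -αxy`, `∂ₜy = αx²` … the total energy `x²+y²` is conserved
  … explicit solution `x(t) = A sech(αAt)`, `y(t) = A tanh(αAt)`." Here: `pumpGate α`,
  `isCancelling_pumpGate`, `pump_output_monotone` ("`y` is increasing"), `pumpSolution α A` with
  `hasDerivAt_pumpSolution`, `pumpSolution_zero`.
* §5.3 the AMPLIFIER (amp), (y-gronwall): "`∂ₜx = -αy²`, `∂ₜy = αxy` … `y(t) = exp(α∫_{t₀}^t x) y(t₀)`
  … explicit solution `x = A tanh(αA(T-t))`, `y = A sech(αA(T-t))`." Here: `amplifierGate α`,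
  `isCancelling_amplifierGate`, the PROVED Grönwall identity `amplifier_output_eq`,
  `amplifierSolution` with `hasDerivAt_amplifierSolution`.
* §5.4 the ROTOR (rotor-def): "`∂ₜx = -αyz`, `∂ₜy = αxz`, `∂ₜz = 0` … preserves `x²+y²+z²` … explicit
  [rotation at angular rate `αz(t₀)`] … equipartition of energy identity `αz(x²-y²) = ∂ₜ(xy)`."
  Here: `rotorGate α`, `isCancelling_rotorGate`, `rotor_driver_const`, `rotor_equipartition`,
  `rotorSolution` with `hasDerivAt_rotorSolution`.
* §5.5 (the five-mode delay circuit and Theorem 5.3) is the sibling file `DelayCircuit.lean`, which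
  wires these gates together exactly as printed and records Thm 5.3 as a named fact.
* §5.2, Prop. 5.1 (blow-up for the exogenously truncated dyadic model) is ALREADY in the tree and
  PROVED: `Literature.Barriers.NavierStokesRegularity.TruncatedDyadic.Tao2016_prop51`
  (`…_holds`, `TruncatedDyadicBlowupProofs.lean`; its dissipative pump gate is
  `TruncatedDyadic.pumpField ε ε'`, whose `ε = ε' = 0` case is `pumpGate 1` here up to the
  identification `ℝ × ℝ ≃ (Fin 2 → ℝ)`). Not restated.

## Where the REST of the paper lives in the tree (index; nothing below is restated here)

| Tao 2016 | in-tree declaration (all `Literature.Analysis.FluidPDE.…` unless noted) | status |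
|---|---|---|
| (1.15) mild `H¹⁰_df` solution; (1.3)/(1.4) Euler form; (1.12)/(1.13) averaging | `Tao2016.IsMildSolutionFor`, `Tao2016.eulerForm`, `Tao2016.AveragingDatum` (`TaoAveragedSobolev.lean`) | defs |
| **Thm 1.5** (blow-up for an averaged NS) | `Tao2016.averagedNS_blowup` | PROVED `Tao2016.averagedNS_blowup_holds` (`TaoAveragedCascadeHolds.lean`) |
| Thm 3.2 (local cascade operators are averaged Euler) | `Tao2016.localCascade_isAveraged` | PROVED `…_holds` |
| Thm 3.3 (blow-up for a local cascade equation); Thm 1.5 ⇐ 3.2 ∧ 3.3 | `Tao2016.localCascade_blowup`; `Tao2016.averagedNS_blowup_of_cascade` | PROVED |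
| (4.1) cascade operator, wavelet data | `Tao2016.cascadeOperatorForm`, `CascadeWaveletData` (`TaoCascadeOperator.lean`) | defs |
| Lemma 4.1 (equations of motion); Thm 3.3 ⇐ Thm 4.2 | `Tao2016.equationsOfMotion` (`…_holds`), `Tao2016.localCascade_blowup_of_odeBlowup`, `Tao2016.averagedNS_blowup_of_leaves` | PROVED |
| (4.2)/(4.3) symmetric + cancelling structure constants; cascade ODE solutions | `TaoCascade.IsSymmetricCoeff`, `TaoCascade.IsCancellingCoeff`, `TaoCascade.CascadeODESolution`, `TaoCascade.TaoODESystem` (`TaoCascadeODE.lean`) | defs |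
| **Thm 4.2** (ODE blow-up) | `TaoCascade.odeBlowup` | PROVED `TaoCascade.odeBlowup_holds` |
| **Thm 6.2** (no global ODE solution); Props 6.3/6.4 ⇒ Thm 6.2 | `TaoCascade.noGlobalODESolution`; `TaoCascade.blowupDynamics`, `TaoCascade.blowupDynamicsStep`, `TaoCascade.noGlobalODESolution_of_blowupDynamics`, `…_of_blowupDynamicsStep` (`TaoCascadeBlowupDynamics.lean`) | PROVED (`…Holds.lean`) |
| §6.4–6.6 (Prop. 6.5, (6.45)–(6.133)) | `TaoCascade.RescaledHypotheses` and `TaoCascadeRescaled*`, `TaoCascadeZeroScale*`, `TaoCascadeFiveModes`, `TaoCascadeDrain*`, `TaoCascadeCoarse*` | PROVED |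
| Prop. 5.1 (truncated dyadic blow-up), Type-I/DSS facets | `Literature.Barriers.NavierStokesRegularity.TruncatedDyadic.Tao2016_prop51` (+ `_endpoint`, `_dss`) | PROVED |
| barrier reading of Thm 1.5 (§1.3, p. 8) | `Literature.Barriers.NavierStokesRegularity.TaoAveragedBlowup`, `….AveragedTypeIBlowup` | catalogue |

Logical structure of the paper, as kernel-checked in the tree:
`odeBlowup (Thm 4.2) ⟸ noGlobalODESolution (Thm 6.2) ⟸ blowupDynamics (Props 6.3/6.4)`;
`localCascade_blowup (Thm 3.3) ⟸ equationsOfMotion (Lemma 4.1) ∧ odeBlowup`;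
`averagedNS_blowup (Thm 1.5) ⟸ localCascade_isAveraged (Thm 3.2) ∧ localCascade_blowup`.
§5 (this file and `DelayCircuit.lean`) is, in Tao's words (p. 25), "not actually needed for the
proof of our main results" — it is the design document for the gates, which is what a gadget
designer for TRUE Navier–Stokes needs (cell pub-fluidc, DICTIONARY.md: circuit element ↔ gadget
field).

## Design choices
* Modes are `Fin m → ℝ` (sup-norm Pi type; only `HasDerivAt` componentwise is used), energy is the
  plain sum of squares. A bilinear `G` on `ℝ^m` is recorded by its structure constants — the same
  bookkeeping as the tree's `TaoCascade.IsCancellingCoeff` for the infinite cascade (4.3).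
* Conservation laws are proved for GLOBAL solutions (`∀ t, HasDerivAt X (F (X t)) t`); every circuit
  here is globally well posed, so this is the printed setting "`X : [t₁,t₂] → ℝ^m`" up to
  restriction.
* `sech = (cosh)⁻¹`, `tanh = sinh / cosh` are written out (as in `TruncatedDyadic.pumpExplicit`).

## References
* T. Tao, JAMS 29 (2016) 601–674, arXiv:1402.0290: §5 (ode), (g-cancel) p. 25; §5.1 (pump), (pomp)
  p. 25; §5.3 (amp), (y-gronwall) p. 27; §5.4 (rotor-def) p. 27. [`Tao2016AveragedNS`]
-/

noncomputable section

namespace Literature.Analysis.FluidPDE.Tao2016AveragedNS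

variable {m : ℕ}

/-! ## Quadratic circuits: (ode) and the cancellation (g-cancel) -/

/-- The energy `|X|² = ∑ᵢ Xᵢ²` of a state of an `m`-mode circuit ("the norm of `X`", §5 p. 25).
[cite: Tao2016AveragedNS, §5 (ode)] -/
def energy (X : Fin m → ℝ) : ℝ := ∑ i, X i ^ 2

/-- The cancellation condition (g-cancel) for a vector field `F` on `ℝ^m`: `F(X)·X = 0` for all `X`.
[cite: Tao2016AveragedNS, §5 (g-cancel)] -/
def IsCancelling (F : (Fin m → ℝ) → (Fin m → ℝ)) : Prop := ∀ X : Fin m → ℝ, ∑ i, F X i * X i = 0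

/-- A **quadratic circuit** on `m` modes (§5, (ode)–(g-cancel)): a bilinear operator
`G : ℝ^m × ℝ^m → ℝ^m`, recorded by its (real, size-unrestricted) structure constants
`G(X,Y)ᵢ = ∑_{j,k} coeff i j k · Xⱼ Yₖ`, obeying the cancellation `G(X,X)·X = 0`.
[cite: Tao2016AveragedNS, §5 (ode), (g-cancel)] -/
structure QuadraticCircuit (m : ℕ) where
  /-- structure constants of the bilinear operator `G` -/
  coeff : Fin m → Fin m → Fin m → ℝ
  /-- (g-cancel): `G(X,X)·X = 0` -/
  cancel : ∀ X : Fin m → ℝ, ∑ i, (∑ j, ∑ k, coeff i j k * X j * X k) * X i = 0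

namespace QuadraticCircuit

/-- The bilinear operator `G(X,Y)` of a quadratic circuit. [cite: Tao2016AveragedNS, §5 (ode)] -/
def G (c : QuadraticCircuit m) (X Y : Fin m → ℝ) : Fin m → ℝ :=
  fun i => ∑ j, ∑ k, c.coeff i j k * X j * Y k

/-- The vector field `X ↦ G(X,X)` of the circuit (ode). [cite: Tao2016AveragedNS, §5 (ode)] -/
def field (c : QuadraticCircuit m) (X : Fin m → ℝ) : Fin m → ℝ := c.G X X

/-- `G` is additive in its first argument (and likewise in the second). [folklore] -/
theorem G_add_left (c : QuadraticCircuit m) (X X' Y : Fin m → ℝ) :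
    c.G (X + X') Y = c.G X Y + c.G X' Y := by
  ext i
  simp only [G, Pi.add_apply, mul_add, add_mul, Finset.sum_add_distrib]

/-- `G` is homogeneous in its first argument (and likewise in the second). [folklore] -/
theorem G_smul_left (c : QuadraticCircuit m) (a : ℝ) (X Y : Fin m → ℝ) :
    c.G (a • X) Y = a • c.G X Y := by
  ext i
  simp only [G, Pi.smul_apply, smul_eq_mul, Finset.mul_sum]
  exact Finset.sum_congr rfl fun j _ => Finset.sum_congr rfl fun k _ => by ring

/-- The circuit's vector field obeys (g-cancel). [cite: Tao2016AveragedNS, §5 (g-cancel)] -/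
theorem isCancelling_field (c : QuadraticCircuit m) : IsCancelling c.field := c.cancel

/-- A (global) trajectory of the circuit: `∂ₜX = G(X,X)` at every time.
[cite: Tao2016AveragedNS, §5 (ode)] -/
def IsSolution (c : QuadraticCircuit m) (X : ℝ → Fin m → ℝ) : Prop :=
  ∀ t, HasDerivAt X (c.field (X t)) t

end QuadraticCircuit

/-- Sums of cancelling fields cancel ("the system is composed of gates, each of which individually
satisfy this condition", §5.5 p. 28). [cite: Tao2016AveragedNS, §5.5] -/
theorem IsCancelling.add {F F' : (Fin m → ℝ) → (Fin m → ℝ)} (hF : IsCancelling F)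
    (hF' : IsCancelling F') : IsCancelling (F + F') := by
  intro X
  simp only [Pi.add_apply, add_mul, Finset.sum_add_distrib, hF X, hF' X, add_zero]

/-- Chain rule for the energy along a differentiable trajectory: `∂ₜ|X|² = 2 V·X`. [folklore] -/
theorem hasDerivAt_energy {X : ℝ → Fin m → ℝ} {V : Fin m → ℝ} {t : ℝ} (hX : HasDerivAt X V t) :
    HasDerivAt (fun s => energy (X s)) (2 * ∑ i, V i * X t i) t := by
  have h : ∀ i ∈ (Finset.univ : Finset (Fin m)),
      HasDerivAt (fun s => X s i ^ 2) (((2 : ℕ) : ℝ) * X t i ^ (2 - 1) * V i) t :=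
    fun i _ => (hasDerivAt_pi.1 hX i).fun_pow 2
  have hs := HasDerivAt.fun_sum h
  refine (hs.congr_deriv ?_)
  rw [Finset.mul_sum]
  refine Finset.sum_congr rfl fun i _ => ?_
  simp only [show (2 : ℕ) - 1 = 1 from rfl, pow_one, Nat.cast_ofNat]
  ring

/-- **The flow (ode) preserves the norm of `X`** (§5 p. 25): a global solution of `∂ₜX = F(X)` with
`F` cancelling has constant energy. [cite: Tao2016AveragedNS, §5 (ode)–(g-cancel)] -/
theorem energy_eq_of_isCancelling {F : (Fin m → ℝ) → (Fin m → ℝ)} (hF : IsCancelling F)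
    {X : ℝ → Fin m → ℝ} (hX : ∀ t, HasDerivAt X (F (X t)) t) (s t : ℝ) :
    energy (X s) = energy (X t) := by
  refine is_const_of_deriv_eq_zero (f := fun r => energy (X r))
    (fun r => (hasDerivAt_energy (hX r)).differentiableAt) (fun r => ?_) s t
  rw [(hasDerivAt_energy (hX r)).deriv, hF (X r), mul_zero]

/-- Energy conservation for a quadratic circuit. [cite: Tao2016AveragedNS, §5 (ode)–(g-cancel)] -/
theorem QuadraticCircuit.energy_eq (c : QuadraticCircuit m) {X : ℝ → Fin m → ℝ}
    (hX : c.IsSolution X) (s t : ℝ) : energy (X s) = energy (X t) :=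
  energy_eq_of_isCancelling c.isCancelling_field hX s t

/-! ## §5.1 The pump gate -/

/-- The **pump** of coupling constant `α` (binary gate, `m = 2`, modes `(x,y) = (X 0, X 1)`):
`∂ₜx = -αxy`, `∂ₜy = αx²` — "energy is being pumped from `x` to `y`".
[cite: Tao2016AveragedNS, §5.1 (pump)] -/
def pumpGate (α : ℝ) (X : Fin 2 → ℝ) : Fin 2 → ℝ := ![-(α * X 0 * X 1), α * X 0 ^ 2]

/-- The pump conserves `x² + y²`. [cite: Tao2016AveragedNS, §5.1] -/
theorem isCancelling_pumpGate (α : ℝ) : IsCancelling (pumpGate α) := by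
  intro X
  simp [pumpGate, Fin.sum_univ_two]
  ring

/-- For `α ≥ 0` the output `y` of a pump is non-decreasing along any global trajectory ("`y` is
increasing", §5.1). [cite: Tao2016AveragedNS, §5.1] -/
theorem pump_output_monotone {α : ℝ} (hα : 0 ≤ α) {X : ℝ → Fin 2 → ℝ}
    (hX : ∀ t, HasDerivAt X (pumpGate α (X t)) t) : Monotone fun t => X t 1 := by
  have hd : ∀ t, HasDerivAt (fun s => X s 1) (α * X t 0 ^ 2) t := fun t => by
    simpa [pumpGate] using hasDerivAt_pi.1 (hX t) 1
  refine monotone_of_deriv_nonneg (fun t => (hd t).differentiableAt) fun t => ?_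
  rw [(hd t).deriv]
  positivity

/-- The explicit pump trajectory (pomp): `x(t) = A sech(αAt)`, `y(t) = A tanh(αAt)`.
[cite: Tao2016AveragedNS, §5.1 (pomp)] -/
def pumpSolution (α A : ℝ) (t : ℝ) : Fin 2 → ℝ :=
  ![A * (Real.cosh (α * A * t))⁻¹, A * (Real.sinh (α * A * t) / Real.cosh (α * A * t))]

/-- (pomp) starts at `(x(0), y(0)) = (A, 0)`. [cite: Tao2016AveragedNS, §5.1 (pomp)] -/
theorem pumpSolution_zero (α A : ℝ) : pumpSolution α A 0 = ![A, 0] := by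
  simp [pumpSolution]

/-- (pomp) solves the pump gate. [cite: Tao2016AveragedNS, §5.1 (pomp)] -/
theorem hasDerivAt_pumpSolution (α A t : ℝ) :
    HasDerivAt (pumpSolution α A) (pumpGate α (pumpSolution α A t)) t := by
  have hc : Real.cosh (α * A * t) ≠ 0 := (Real.cosh_pos _).ne'
  have hid : Real.cosh (α * A * t) ^ 2 - Real.sinh (α * A * t) ^ 2 = 1 :=
    Real.cosh_sq_sub_sinh_sq _
  have hlin : HasDerivAt (fun s : ℝ => α * A * s) (α * A * 1) t :=
    (hasDerivAt_id' t).const_mul (α * A)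
  have hcosh : HasDerivAt (fun s => Real.cosh (α * A * s))
      (Real.sinh (α * A * t) * (α * A * 1)) t := hlin.cosh
  have hsinh : HasDerivAt (fun s => Real.sinh (α * A * s))
      (Real.cosh (α * A * t) * (α * A * 1)) t := hlin.sinh
  have h0 : HasDerivAt (fun s => A * (Real.cosh (α * A * s))⁻¹)
      (A * (-(Real.sinh (α * A * t) * (α * A * 1)) / Real.cosh (α * A * t) ^ 2)) t :=
    (hcosh.fun_inv hc).const_mul A
  have h1 : HasDerivAt (fun s => A * (Real.sinh (α * A * s) / Real.cosh (α * A * s)))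
      (A * ((Real.cosh (α * A * t) * (α * A * 1) * Real.cosh (α * A * t) -
        Real.sinh (α * A * t) * (Real.sinh (α * A * t) * (α * A * 1))) /
          Real.cosh (α * A * t) ^ 2)) t :=
    (hsinh.fun_div hcosh hc).const_mul A
  have key : Real.cosh (α * A * t) * (α * A * 1) * Real.cosh (α * A * t) -
      Real.sinh (α * A * t) * (Real.sinh (α * A * t) * (α * A * 1)) = α * A := by
    linear_combination (α * A) * hid
  refine hasDerivAt_pi.2 fun i => ?_
  fin_cases i
  · simp only [Fin.zero_eta, Fin.isValue, pumpSolution, pumpGate, Matrix.cons_val_zero,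
      Matrix.cons_val_one]
    refine h0.congr_deriv ?_
    ring
  · simp only [Fin.mk_one, Fin.isValue, pumpSolution, pumpGate, Matrix.cons_val_zero,
      Matrix.cons_val_one]
    refine h1.congr_deriv ?_
    rw [key]
    ring

/-! ## §5.3 The amplifier gate -/

/-- The **amplifier** of coupling constant `α` (binary gate, modes `(x,y) = (X 0, X 1)`):
`∂ₜx = -αy²`, `∂ₜy = αxy` — "the `x` mode causes exponential amplification in the `y` mode".
[cite: Tao2016AveragedNS, §5.3 (amp)] -/
def amplifierGate (α : ℝ) (X : Fin 2 → ℝ) : Fin 2 → ℝ := ![-(α * X 1 ^ 2), α * X 0 * X 1]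

/-- The amplifier conserves `x² + y²`. [cite: Tao2016AveragedNS, §5.3] -/
theorem isCancelling_amplifierGate (α : ℝ) : IsCancelling (amplifierGate α) := by
  intro X
  simp [amplifierGate, Fin.sum_univ_two]
  ring

/-- The amplifier law behind (y-gronwall), primitive form: if `∂ₜΦ = αx` and `∂ₜy = αxy` then
`y(t) = exp(Φ(t) - Φ(t₀)) y(t₀)`. [folklore] -/
theorem amplifier_output_eq_of_primitive {α : ℝ} {x y Φ : ℝ → ℝ}
    (hΦ : ∀ t, HasDerivAt Φ (α * x t) t) (hy : ∀ t, HasDerivAt y (α * x t * y t) t) (t₀ t : ℝ) :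
    y t = Real.exp (Φ t - Φ t₀) * y t₀ := by
  have hg : ∀ s, HasDerivAt (fun r => y r * Real.exp (-Φ r)) 0 s := by
    intro s
    have he : HasDerivAt (fun r => Real.exp (-Φ r)) (Real.exp (-Φ s) * -(α * x s)) s :=
      (hΦ s).fun_neg.exp
    refine ((hy s).fun_mul he).congr_deriv ?_
    ring
  have hconst : y t * Real.exp (-Φ t) = y t₀ * Real.exp (-Φ t₀) :=
    is_const_of_deriv_eq_zero (f := fun r => y r * Real.exp (-Φ r))
      (fun s => (hg s).differentiableAt) (fun s => (hg s).deriv) t t₀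
  calc y t = y t * Real.exp (-Φ t) * Real.exp (Φ t) := by
        rw [mul_assoc, ← Real.exp_add, neg_add_cancel, Real.exp_zero, mul_one]
    _ = y t₀ * Real.exp (-Φ t₀) * Real.exp (Φ t) := by rw [hconst]
    _ = Real.exp (Φ t - Φ t₀) * y t₀ := by
        rw [mul_assoc, ← Real.exp_add, show -Φ t₀ + Φ t = Φ t - Φ t₀ by ring, mul_comm]

/-- **(y-gronwall)**: if `∂ₜy = α x y` with `x` continuous then `y(t) = exp(α ∫_{t₀}^t x) · y(t₀)` —
the amplifier law, stated for the output equation alone so that it applies verbatim to the `y`-mode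
of an amplifier whatever forcing acts on `x`. [cite: Tao2016AveragedNS, §5.3 (y-gronwall)] -/
theorem amplifier_output_eq {α : ℝ} {x y : ℝ → ℝ} (hx : Continuous x)
    (hy : ∀ t, HasDerivAt y (α * x t * y t) t) (t₀ t : ℝ) :
    y t = Real.exp (α * ∫ s in t₀..t, x s) * y t₀ := by
  have hΦ : ∀ r, HasDerivAt (fun r => α * ∫ s in t₀..r, x s) (α * x r) r := fun r =>
    (hx.integral_hasStrictDerivAt t₀ r).hasDerivAt.const_mul α
  simpa [intervalIntegral.integral_same] using amplifier_output_eq_of_primitive hΦ hy t₀ t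

/-- The explicit amplifier trajectory: `x(t) = A tanh(αA(T-t))`, `y(t) = A sech(αA(T-t))`.
[cite: Tao2016AveragedNS, §5.3] -/
def amplifierSolution (α A T : ℝ) (t : ℝ) : Fin 2 → ℝ :=
  ![A * (Real.sinh (α * A * (T - t)) / Real.cosh (α * A * (T - t))),
    A * (Real.cosh (α * A * (T - t)))⁻¹]

/-- The explicit trajectory solves the amplifier gate. [cite: Tao2016AveragedNS, §5.3] -/
theorem hasDerivAt_amplifierSolution (α A T t : ℝ) :
    HasDerivAt (amplifierSolution α A T) (amplifierGate α (amplifierSolution α A T t)) t := by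
  have hc : Real.cosh (α * A * (T - t)) ≠ 0 := (Real.cosh_pos _).ne'
  have hid : Real.cosh (α * A * (T - t)) ^ 2 - Real.sinh (α * A * (T - t)) ^ 2 = 1 :=
    Real.cosh_sq_sub_sinh_sq _
  have hlin : HasDerivAt (fun s : ℝ => α * A * (T - s)) (α * A * -1) t :=
    ((hasDerivAt_id' t).const_sub T).const_mul (α * A)
  have hcosh : HasDerivAt (fun s => Real.cosh (α * A * (T - s)))
      (Real.sinh (α * A * (T - t)) * (α * A * -1)) t := hlin.cosh
  have hsinh : HasDerivAt (fun s => Real.sinh (α * A * (T - s)))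
      (Real.cosh (α * A * (T - t)) * (α * A * -1)) t := hlin.sinh
  have h0 : HasDerivAt (fun s => A * (Real.sinh (α * A * (T - s)) / Real.cosh (α * A * (T - s))))
      (A * ((Real.cosh (α * A * (T - t)) * (α * A * -1) * Real.cosh (α * A * (T - t)) -
        Real.sinh (α * A * (T - t)) * (Real.sinh (α * A * (T - t)) * (α * A * -1))) /
          Real.cosh (α * A * (T - t)) ^ 2)) t :=
    (hsinh.fun_div hcosh hc).const_mul A
  have h1 : HasDerivAt (fun s => A * (Real.cosh (α * A * (T - s)))⁻¹)
      (A * (-(Real.sinh (α * A * (T - t)) * (α * A * -1)) / Real.cosh (α * A * (T - t)) ^ 2)) t :=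
    (hcosh.fun_inv hc).const_mul A
  have key : Real.cosh (α * A * (T - t)) * (α * A * -1) * Real.cosh (α * A * (T - t)) -
      Real.sinh (α * A * (T - t)) * (Real.sinh (α * A * (T - t)) * (α * A * -1)) = -(α * A) := by
    linear_combination (-(α * A)) * hid
  refine hasDerivAt_pi.2 fun i => ?_
  fin_cases i
  · simp only [Fin.zero_eta, Fin.isValue, amplifierSolution, amplifierGate, Matrix.cons_val_zero,
      Matrix.cons_val_one]
    refine h0.congr_deriv ?_
    rw [key]
    ring
  · simp only [Fin.mk_one, Fin.isValue, amplifierSolution, amplifierGate, Matrix.cons_val_zero,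
      Matrix.cons_val_one]
    refine h1.congr_deriv ?_
    ring

/-! ## §5.4 The rotor gate -/

/-- The **rotor** of coupling constant `α` (ternary gate, modes `(x,y,z) = (X 0, X 1, X 2)`):
`∂ₜx = -αyz`, `∂ₜy = αxz`, `∂ₜz = 0` — "the `z` mode drives the oscillating interchange of energy
between the `x` and `y` modes". [cite: Tao2016AveragedNS, §5.4 (rotor-def)] -/
def rotorGate (α : ℝ) (X : Fin 3 → ℝ) : Fin 3 → ℝ := ![-(α * X 1 * X 2), α * X 0 * X 2, 0]

/-- The rotor conserves `x² + y² + z²`. [cite: Tao2016AveragedNS, §5.4] -/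
theorem isCancelling_rotorGate (α : ℝ) : IsCancelling (rotorGate α) := by
  intro X
  simp [rotorGate, Fin.sum_univ_three]
  ring

/-- The driver `z` of a rotor is constant. [cite: Tao2016AveragedNS, §5.4] -/
theorem rotor_driver_const {α : ℝ} {X : ℝ → Fin 3 → ℝ}
    (hX : ∀ t, HasDerivAt X (rotorGate α (X t)) t) (s t : ℝ) : X s 2 = X t 2 := by
  have hd : ∀ t, HasDerivAt (fun s => X s 2) 0 t := fun t => by
    simpa [rotorGate] using hasDerivAt_pi.1 (hX t) 2
  exact is_const_of_deriv_eq_zero (f := fun r => X r 2) (fun r => (hd r).differentiableAt)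
    (fun r => (hd r).deriv) s t

/-- The combined energy `x² + y²` of the rotating pair is conserved: `∂ₜ(x²+y²) = 0`.
[cite: Tao2016AveragedNS, §5.4] -/
theorem rotor_pair_energy {α : ℝ} {X : ℝ → Fin 3 → ℝ} {t : ℝ}
    (hX : HasDerivAt X (rotorGate α (X t)) t) :
    HasDerivAt (fun s => X s 0 ^ 2 + X s 1 ^ 2) 0 t := by
  refine (((hasDerivAt_pi.1 hX 0).fun_pow 2).fun_add ((hasDerivAt_pi.1 hX 1).fun_pow 2)).congr_deriv ?_
  simp only [show (2 : ℕ) - 1 = 1 from rfl, pow_one, Nat.cast_ofNat, rotorGate, Fin.isValue,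
    Matrix.cons_val_zero, Matrix.cons_val_one]
  ring

/-- **Equipartition of energy identity** `αz(x² - y²) = ∂ₜ(xy)`. [cite: Tao2016AveragedNS, §5.4] -/
theorem rotor_equipartition {α : ℝ} {X : ℝ → Fin 3 → ℝ} {t : ℝ}
    (hX : HasDerivAt X (rotorGate α (X t)) t) :
    HasDerivAt (fun s => X s 0 * X s 1) (α * X t 2 * (X t 0 ^ 2 - X t 1 ^ 2)) t := by
  refine ((hasDerivAt_pi.1 hX 0).fun_mul (hasDerivAt_pi.1 hX 1)).congr_deriv ?_
  simp only [rotorGate, Fin.isValue, Matrix.cons_val_zero, Matrix.cons_val_one]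
  ring

/-- The explicit rotor trajectory from `(x₀, y₀, z₀)` at time `0`: rotation of `(x,y)` at the constant
angular rate `αz₀`, `z ≡ z₀`. [cite: Tao2016AveragedNS, §5.4] -/
def rotorSolution (α x₀ y₀ z₀ : ℝ) (t : ℝ) : Fin 3 → ℝ :=
  ![x₀ * Real.cos (α * z₀ * t) - y₀ * Real.sin (α * z₀ * t),
    y₀ * Real.cos (α * z₀ * t) + x₀ * Real.sin (α * z₀ * t), z₀]

/-- The explicit trajectory solves the rotor gate. [cite: Tao2016AveragedNS, §5.4] -/
theorem hasDerivAt_rotorSolution (α x₀ y₀ z₀ t : ℝ) :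
    HasDerivAt (rotorSolution α x₀ y₀ z₀) (rotorGate α (rotorSolution α x₀ y₀ z₀ t)) t := by
  have hlin : HasDerivAt (fun s : ℝ => α * z₀ * s) (α * z₀ * 1) t :=
    (hasDerivAt_id' t).const_mul (α * z₀)
  have hcos : HasDerivAt (fun s => Real.cos (α * z₀ * s))
      (-Real.sin (α * z₀ * t) * (α * z₀ * 1)) t := hlin.cos
  have hsin : HasDerivAt (fun s => Real.sin (α * z₀ * s))
      (Real.cos (α * z₀ * t) * (α * z₀ * 1)) t := hlin.sin
  refine hasDerivAt_pi.2 fun i => ?_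
  fin_cases i
  · simp only [Fin.zero_eta, Fin.isValue, rotorSolution, rotorGate, Matrix.cons_val_zero,
      Matrix.cons_val_one, Matrix.cons_val_two, Matrix.head_cons, Matrix.tail_cons]
    refine ((hcos.const_mul x₀).fun_sub (hsin.const_mul y₀)).congr_deriv ?_
    ring
  · simp only [Fin.mk_one, Fin.isValue, rotorSolution, rotorGate, Matrix.cons_val_zero,
      Matrix.cons_val_one, Matrix.cons_val_two, Matrix.head_cons, Matrix.tail_cons]
    refine ((hcos.const_mul y₀).fun_add (hsin.const_mul x₀)).congr_deriv ?_
    ring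
  · simp only [Fin.reduceFinMk, Fin.isValue, rotorSolution, rotorGate, Matrix.cons_val_zero,
      Matrix.cons_val_one, Matrix.cons_val_two, Matrix.head_cons, Matrix.tail_cons]
    exact hasDerivAt_const t z₀

end Literature.Analysis.FluidPDE.Tao2016AveragedNS
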